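import Summits.AtomisticToContinuum.HydrodynamicLimit.Theorems.EnskogAdjointDualityAdjointEnskogTestFamilyRKernelDipolePrep2

/-!
# Contraction of the `ℓ = 1` sector (K1): stub `kernelDipole`

Stub `kernelDipole` of the refutation line of the crux `AdjointEnskogTestFamilyR`
(route `EnskogAdjointDuality`): for the dipole weight `ϑ¹_R(E) = √E (1+E)⁻⁴ e^{-E/R}` the dual
kernel `2g(E) - n(√E)ϑ¹_R(E)` equals `-(π/5)√E ϑ¹_R(E)` up to an error whose
`∫₀^∞ (1+E)E|·|dE` is bounded uniformly in `R ≥ 1`.  This file proves the pointwise weighted bound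
by the dominating function `C/(√E(1+E)) + (4π/5)R⁻¹e^{-E/R}` (six elementary terms, crude constant
`C = 3202070 π`), the measurability of the reduced gain, and assembles the registered statement
`stub_kernelDipole`.  The weight and its tail are written out explicitly (no auxiliary definitions).
-/

noncomputable section

namespace Summit.AtomisticToContinuum.HydrodynamicLimit.Theorems.EnskogAdjointDuality

open MeasureTheory Set Filter
open scoped Real Topology

/-! ### The pointwise weighted bound -/

/-- **Core pointwise bound.** For `R ≥ 1`, `E > 0`: the weighted dipole kernel error is below the
dominating function `C/(√E(1+E)) + (4π/5) R⁻¹ e^{-E/R}`. -/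
theorem k2r_ref_K1_core {h n : ℝ → ℝ} (hc : Continuous h)
    (hh : ∀ a, 0 ≤ h a - max a 0 ∧ h a - max a 0 ≤ Real.exp (-a ^ 2 / 2))
    (hn : ∀ u, 0 ≤ u → Real.pi * u ≤ n u ∧ n u ≤ Real.pi * Real.sqrt (u ^ 2 + 3))
    {R E : ℝ} (hR : 1 ≤ R) (hE : 0 < E) :
    (1 + E) * E * |2 * (Real.pi * ∫ t in (-1:ℝ)..1, t ^ 2 * Real.exp (-(E * (1 - t ^ 2)) / 2) *
        h (Real.sqrt E * t) * (∫ y in Set.Ioi (E * t ^ 2), Real.sqrt y * ((1 + y) ^ 4)⁻¹ * Real.exp (-y / R)))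
      - n (Real.sqrt E) * (Real.sqrt E * ((1 + E) ^ 4)⁻¹ * Real.exp (-E / R)) + Real.pi / 5 * Real.sqrt E * (Real.sqrt E * ((1 + E) ^ 4)⁻¹ * Real.exp (-E / R))|
    ≤ (Real.pi * 3202070) * (Real.sqrt E * (1 + E))⁻¹ + (4 * Real.pi / 5) * (R⁻¹ * Real.exp (-E / R)) := by
  have hR0 : 0 < R := by linarith
  obtain ⟨D, I₂, hD0, hDle, hI₂, hg⟩ := k2r_ref_K1_gain_decomp hc hh hR0 hE
  obtain ⟨T, S, hT0, hTle, hS0, hSle, hid⟩ := k2r_ref_K1_Tb_identity hR0 hE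
  have hφ0 := k2r_ref_K1_th_nonneg R E
  have hφle := k2r_ref_K1_th_le_sqrt hR0 hE.le
  have hΘ0 := k2r_ref_K1_Tb_nonneg R E
  have hΘle := k2r_ref_K1_Tb_le hR0 hE.le
  rw [hg]
  set φ := (Real.sqrt E * ((1 + E) ^ 4)⁻¹ * Real.exp (-E / R)) with hφ
  set Θ := (∫ y in Set.Ioi E, Real.sqrt y * ((1 + y) ^ 4)⁻¹ * Real.exp (-y / R)) with hΘ
  have hsE : Real.sqrt E ^ 2 = E := Real.sq_sqrt hE.le
  set s := Real.sqrt E with hs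
  have hs0 : 0 < s := Real.sqrt_pos.mpr hE
  obtain ⟨hn1, hn2⟩ := hn s hs0.le
  have hE1 : 0 < 1 + E := by linarith
  have hsE1 : 0 < s * (1 + E) := by positivity
  have hW : 0 ≤ (1 + E) * E := by positivity
  have hM0 : 0 ≤ (s * (1 + E))⁻¹ := by positivity
  have hexR : Real.exp (-E / R) ≤ 1 := Real.exp_le_one_iff.mpr (by
    rw [neg_div]; exact neg_nonpos.mpr (div_nonneg hE.le hR0.le))
  have hsle : s ≤ (1 + E) / 2 := Literature.Barriers.AnomalousDissipation.Torus.sqrt_le_half_one_add hE.le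
  -- the algebraic decomposition into six terms
  have hΘeq : Θ = (2 / 5) * (E * φ) + (8 / 5) * T - (2 / 5) * R⁻¹ * S := by linarith
  have hX : 2 * (Real.pi * (s * (Θ * (1 / E - 2 / E ^ 2 + 2 * Real.exp (-E / 2) / E ^ 2) + D) + I₂))
      - n s * φ + Real.pi / 5 * s * φ
      = (Real.pi * s - n s) * φ + (16 * Real.pi / 5) * (s * T / E)
        + -((4 * Real.pi / 5) * (s * S * R⁻¹ / E))
        + 4 * Real.pi * (s * Θ * (Real.exp (-E / 2) - 1) / E ^ 2)
        + 2 * Real.pi * (s * D) + 2 * Real.pi * I₂ := by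
    have hEinv : E * E⁻¹ = 1 := mul_inv_cancel₀ hE.ne'
    rw [hΘeq]
    linear_combination (4 * Real.pi / 5) * s * φ * hEinv
  rw [hX]
  clear hX hg hΘeq hid
  -- the six weighted bounds
  have hb1 : s * (1 + E) * ((1 + E) * E * |(Real.pi * s - n s) * φ|) ≤ 3 * Real.pi / 2 := by
    have hq0 : 0 ≤ Real.sqrt (s ^ 2 + 3) := Real.sqrt_nonneg _
    have hq2 : Real.sqrt (s ^ 2 + 3) ^ 2 = s ^ 2 + 3 := Real.sq_sqrt (by positivity)
    have hq : (Real.sqrt (s ^ 2 + 3) - s) * s ≤ 3 / 2 := by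
      nlinarith only [sq_nonneg (Real.sqrt (s ^ 2 + 3) - s), hq2]
    have hqs : 0 ≤ Real.sqrt (s ^ 2 + 3) - s := by
      have : s ≤ Real.sqrt (s ^ 2 + 3) := by
        rw [Real.le_sqrt hs0.le (by positivity)]; linarith
      linarith
    have ht1 : (Real.pi * s - n s) * φ ≤ 0 :=
      mul_nonpos_of_nonpos_of_nonneg (by linarith only [hn1]) hφ0
    rw [abs_of_nonpos ht1]
    have hEs : E * s / (1 + E) ^ 2 ≤ 1 := by
      rw [div_le_one (by positivity)]
      have := mul_le_mul_of_nonneg_left hsle hE.le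
      nlinarith only [this, hE]
    calc s * (1 + E) * ((1 + E) * E * -((Real.pi * s - n s) * φ))
        = s * (1 + E) * ((1 + E) * E * ((n s - Real.pi * s) * φ)) := by ring
      _ ≤ s * (1 + E) * ((1 + E) * E * ((Real.pi * (Real.sqrt (s ^ 2 + 3) - s)) *
            (s * ((1 + E) ^ 4)⁻¹))) := by gcongr; linarith only [hn2]
      _ = Real.pi * (E * s / (1 + E) ^ 2) * ((Real.sqrt (s ^ 2 + 3) - s) * s) := by
            field_simp
      _ ≤ Real.pi * 1 * (3 / 2) := by gcongr
      _ = 3 * Real.pi / 2 := by ring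
  have hb2 : s * (1 + E) * ((1 + E) * E * |(16 * Real.pi / 5) * (s * T / E)|) ≤ 16 * Real.pi / 15 := by
    rw [abs_of_nonneg (by positivity)]
    calc s * (1 + E) * ((1 + E) * E * ((16 * Real.pi / 5) * (s * T / E)))
        = (16 * Real.pi / 5) * (s ^ 2 * (1 + E) ^ 2) * T := by field_simp
      _ ≤ (16 * Real.pi / 5) * (s ^ 2 * (1 + E) ^ 2) * ((1 / 3) * ((1 + E) ^ 3)⁻¹) := by gcongr
      _ = (16 * Real.pi / 15) * (E / (1 + E)) := by rw [hsE]; field_simp; norm_num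
      _ ≤ (16 * Real.pi / 15) * 1 := by
            gcongr; rw [div_le_one hE1]; linarith only
      _ = _ := mul_one _
  have hb3 : (1 + E) * E * |-((4 * Real.pi / 5) * (s * S * R⁻¹ / E))|
      ≤ (4 * Real.pi / 5) * (R⁻¹ * Real.exp (-E / R)) := by
    rw [abs_neg, abs_of_nonneg (by positivity)]
    calc (1 + E) * E * ((4 * Real.pi / 5) * (s * S * R⁻¹ / E))
        = (4 * Real.pi / 5) * R⁻¹ * ((1 + E) * s) * S := by field_simp
      _ ≤ (4 * Real.pi / 5) * R⁻¹ * ((1 + E) * s) * (Real.exp (-E / R) * (s * (1 + E))⁻¹) := by gcongr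
      _ = (4 * Real.pi / 5) * (R⁻¹ * Real.exp (-E / R)) := by field_simp
  have hb4 : s * (1 + E) * ((1 + E) * E * |4 * Real.pi * (s * Θ * (Real.exp (-E / 2) - 1) / E ^ 2)|)
      ≤ Real.pi := by
    have he1 : Real.exp (-E / 2) ≤ 1 := Real.exp_le_one_iff.mpr (by linarith only [hE])
    have he0 : 0 < Real.exp (-E / 2) := Real.exp_pos _
    have habs : |4 * Real.pi * (s * Θ * (Real.exp (-E / 2) - 1) / E ^ 2)|
        = 4 * Real.pi * (s * Θ * (1 - Real.exp (-E / 2)) / E ^ 2) := by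
      rw [abs_of_nonpos]
      · ring
      · have h6 : 0 ≤ 4 * Real.pi * (s * Θ * (1 - Real.exp (-E / 2)) / E ^ 2) := by
          have : 0 ≤ 1 - Real.exp (-E / 2) := by linarith only [he1]
          positivity
        linarith only [h6, show 4 * Real.pi * (s * Θ * (Real.exp (-E / 2) - 1) / E ^ 2)
          = -(4 * Real.pi * (s * Θ * (1 - Real.exp (-E / 2)) / E ^ 2)) by ring]
    rw [habs]
    calc s * (1 + E) * ((1 + E) * E * (4 * Real.pi * (s * Θ * (1 - Real.exp (-E / 2)) / E ^ 2)))
        = 4 * Real.pi * ((1 + E) ^ 2 * Θ) * (1 - Real.exp (-E / 2)) * (s ^ 2 / E) := by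
            field_simp
      _ ≤ 4 * Real.pi * ((1 + E) ^ 2 * ((1 / 4) * ((1 + E) ^ 2)⁻¹)) * 1 * 1 := by
            gcongr
            · linarith only [he0]
            · rw [hsE, div_self hE.ne']
      _ = Real.pi := by field_simp
  have hb5 : s * (1 + E) * ((1 + E) * E * |2 * Real.pi * (s * D)|) ≤ 16 * Real.pi + Real.pi * 20 ^ 5 := by
    rw [abs_of_nonneg (by positivity)]
    have hpe : (1 + E) ^ 5 * Real.exp (-(E / 4)) ≤ (4 * (5:ℕ)) ^ 5 :=
      k2r_ref_K1_pow_exp_le hE.le (by norm_num) (by norm_num)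
    have h8 : E * (1 + E) ^ 2 * ((1 + E / 2) ^ 3)⁻¹ ≤ 8 := by
      rw [← div_eq_mul_inv, div_le_iff₀ (by positivity)]
      nlinarith only [sq_nonneg E, hE.le]
    have hE5 : E ^ 3 * (1 + E) ^ 2 ≤ (1 + E) ^ 5 := by
      have h9 : E ^ 3 ≤ (1 + E) ^ 3 := by gcongr; linarith only
      nlinarith only [h9, pow_pos hE1 2]
    calc s * (1 + E) * ((1 + E) * E * (2 * Real.pi * (s * D)))
        = 2 * Real.pi * (E * (1 + E) ^ 2) * D * s ^ 2 := by ring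
      _ ≤ 2 * Real.pi * (E * (1 + E) ^ 2) *
            ((1 / 2) * ((1 + E / 2) ^ 3)⁻¹ * (2 / E) + E * Real.exp (-(E / 4)) / 2) * s ^ 2 := by
            gcongr
      _ = 2 * Real.pi * (E * (1 + E) ^ 2 * ((1 + E / 2) ^ 3)⁻¹)
            + Real.pi * ((E ^ 3 * (1 + E) ^ 2) * Real.exp (-(E / 4))) := by rw [hsE]; field_simp
      _ ≤ 2 * Real.pi * 8 + Real.pi * ((1 + E) ^ 5 * Real.exp (-(E / 4))) := by gcongr
      _ ≤ 2 * Real.pi * 8 + Real.pi * (4 * (5:ℕ)) ^ 5 := by gcongr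
      _ = 16 * Real.pi + Real.pi * 20 ^ 5 := by norm_num; ring
  have hb6 : s * (1 + E) * ((1 + E) * E * |2 * Real.pi * I₂|) ≤ Real.pi * 8 ^ 4 / 2 := by
    have hpe : (1 + E) ^ 4 * Real.exp (-(E / 2)) ≤ (2 * (4:ℕ)) ^ 4 :=
      k2r_ref_K1_pow_exp_le hE.le (by norm_num) (by norm_num)
    rw [abs_mul, abs_of_nonneg (by positivity : (0:ℝ) ≤ 2 * Real.pi)]
    have hsE2 : s * E ≤ (1 + E) ^ 2 / 2 := by
      have := mul_le_mul_of_nonneg_right hsle hE.le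
      nlinarith only [this, hE]
    calc s * (1 + E) * ((1 + E) * E * (2 * Real.pi * |I₂|))
        = 2 * Real.pi * ((s * E) * (1 + E) ^ 2) * |I₂| := by ring
      _ ≤ 2 * Real.pi * (((1 + E) ^ 2 / 2) * (1 + E) ^ 2) * (Real.exp (-(E / 2)) / 2) := by gcongr
      _ = Real.pi / 2 * ((1 + E) ^ 4 * Real.exp (-(E / 2))) := by ring
      _ ≤ Real.pi / 2 * (2 * (4:ℕ)) ^ 4 := by gcongr
      _ = Real.pi * 8 ^ 4 / 2 := by norm_num; ring
  -- assemble
  have conv : ∀ {x c : ℝ}, s * (1 + E) * x ≤ c → x ≤ c * (s * (1 + E))⁻¹ := by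
    intro x c hx
    rw [← div_eq_mul_inv, le_div_iff₀ hsE1]; linarith only [hx]
  have hb1' := conv hb1
  have hb2' := conv hb2
  have hb4' := conv hb4
  have hb5' := conv hb5
  have hb6' := conv hb6
  have abs6 : ∀ a b c d e f : ℝ, |a + b + c + d + e + f| ≤ |a| + |b| + |c| + |d| + |e| + |f| := by
    intro a b c d e f
    have h1 := abs_add_le (a + b + c + d + e) f
    have h2 := abs_add_le (a + b + c + d) e
    have h3 := abs_add_le (a + b + c) d
    have h4 := abs_add_le (a + b) c
    have h5 := abs_add_le a b
    linarith
  have habs := abs6 ((Real.pi * s - n s) * φ) ((16 * Real.pi / 5) * (s * T / E))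
    (-((4 * Real.pi / 5) * (s * S * R⁻¹ / E))) (4 * Real.pi * (s * Θ * (Real.exp (-E / 2) - 1) / E ^ 2))
    (2 * Real.pi * (s * D)) (2 * Real.pi * I₂)
  have hsum : (3 * Real.pi / 2 + 16 * Real.pi / 15 + Real.pi + (16 * Real.pi + Real.pi * 20 ^ 5)
      + Real.pi * 8 ^ 4 / 2) * (s * (1 + E))⁻¹ ≤ (Real.pi * 3202070) * (s * (1 + E))⁻¹ := by
    apply mul_le_mul_of_nonneg_right _ hM0
    linarith [Real.pi_pos]
  calc (1 + E) * E * |(Real.pi * s - n s) * φ + (16 * Real.pi / 5) * (s * T / E)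
        + -((4 * Real.pi / 5) * (s * S * R⁻¹ / E))
        + 4 * Real.pi * (s * Θ * (Real.exp (-E / 2) - 1) / E ^ 2)
        + 2 * Real.pi * (s * D) + 2 * Real.pi * I₂|
      ≤ (1 + E) * E * (|(Real.pi * s - n s) * φ| + |(16 * Real.pi / 5) * (s * T / E)|
        + |-((4 * Real.pi / 5) * (s * S * R⁻¹ / E))|
        + |4 * Real.pi * (s * Θ * (Real.exp (-E / 2) - 1) / E ^ 2)|
        + |2 * Real.pi * (s * D)| + |2 * Real.pi * I₂|) := mul_le_mul_of_nonneg_left habs hW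
    _ = (1 + E) * E * |(Real.pi * s - n s) * φ| + (1 + E) * E * |(16 * Real.pi / 5) * (s * T / E)|
        + (1 + E) * E * |-((4 * Real.pi / 5) * (s * S * R⁻¹ / E))|
        + (1 + E) * E * |4 * Real.pi * (s * Θ * (Real.exp (-E / 2) - 1) / E ^ 2)|
        + (1 + E) * E * |2 * Real.pi * (s * D)| + (1 + E) * E * |2 * Real.pi * I₂| := by ring
    _ ≤ 3 * Real.pi / 2 * (s * (1 + E))⁻¹ + 16 * Real.pi / 15 * (s * (1 + E))⁻¹
        + (4 * Real.pi / 5) * (R⁻¹ * Real.exp (-E / R)) + Real.pi * (s * (1 + E))⁻¹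
        + (16 * Real.pi + Real.pi * 20 ^ 5) * (s * (1 + E))⁻¹
        + Real.pi * 8 ^ 4 / 2 * (s * (1 + E))⁻¹ := by linarith only [hb1', hb2', hb3, hb4', hb5', hb6']
    _ = (3 * Real.pi / 2 + 16 * Real.pi / 15 + Real.pi + (16 * Real.pi + Real.pi * 20 ^ 5)
        + Real.pi * 8 ^ 4 / 2) * (s * (1 + E))⁻¹ + (4 * Real.pi / 5) * (R⁻¹ * Real.exp (-E / R)) := by ring
    _ ≤ _ := by linarith only [hsum]

/-! ### Measurability of the reduced gain and the main theorem -/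

/-- The reduced dual gain `E ↦ ∫_{-1}^{1} t² e^{-E(1-t²)/2} h(√E t) Θ̄¹_R(E t²) dt` is measurable. -/
theorem k2r_ref_K1_measurable_gain {h : ℝ → ℝ} (hc : Continuous h) {R : ℝ} (hR : 0 < R) :
    Measurable fun E : ℝ => ∫ t in (-1:ℝ)..1, t ^ 2 * Real.exp (-(E * (1 - t ^ 2)) / 2) *
      h (Real.sqrt E * t) * (∫ y in Set.Ioi (E * t ^ 2), Real.sqrt y * ((1 + y) ^ 4)⁻¹ * Real.exp (-y / R)) := by
  have hmT : Measurable (fun x => (∫ y in Set.Ioi x, Real.sqrt y * ((1 + y) ^ 4)⁻¹ * Real.exp (-y / R))) := k2r_ref_K1_measurable_Tb hR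
  have hmh : Measurable h := hc.measurable
  have h1 : Measurable fun p : ℝ × ℝ => p.2 ^ 2 * Real.exp (-(p.1 * (1 - p.2 ^ 2)) / 2) *
      h (Real.sqrt p.1 * p.2) := by fun_prop
  have h2 : Measurable fun p : ℝ × ℝ => (∫ y in Set.Ioi (p.1 * p.2 ^ 2), Real.sqrt y * ((1 + y) ^ 4)⁻¹ * Real.exp (-y / R)) :=
    hmT.comp (by fun_prop : Measurable fun p : ℝ × ℝ => p.1 * p.2 ^ 2)
  have hG : Measurable fun p : ℝ × ℝ => p.2 ^ 2 * Real.exp (-(p.1 * (1 - p.2 ^ 2)) / 2) *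
      h (Real.sqrt p.1 * p.2) * (∫ y in Set.Ioi (p.1 * p.2 ^ 2), Real.sqrt y * ((1 + y) ^ 4)⁻¹ * Real.exp (-y / R)) := h1.mul h2
  have key := (StronglyMeasurable.integral_prod_right' (ν := volume.restrict (Ioc (-1:ℝ) 1))
    hG.stronglyMeasurable).measurable
  simpa [intervalIntegral.integral_of_le (show (-1:ℝ) ≤ 1 by norm_num)] using key

/-- **Main statement (K1), in terms of the named weight/tail.** -/
theorem k2r_ref_K1_main : ∀ h : ℝ → ℝ, Continuous h →
    (∀ a, 0 ≤ h a - max a 0 ∧ h a - max a 0 ≤ Real.exp (-a ^ 2 / 2)) →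
    (∀ a, h a - h (-a) = a) →
    ∀ n : ℝ → ℝ, Measurable n →
    (∀ u, 0 ≤ u → Real.pi * u ≤ n u ∧ n u ≤ Real.pi * Real.sqrt (u ^ 2 + 3)) →
    ∃ M₁ : ℝ, ∀ R : ℝ, 1 ≤ R →
      IntegrableOn (fun E => (1 + E) * E *
        |2 * (Real.pi * ∫ t in (-1 : ℝ)..1, t ^ 2 * Real.exp (-(E * (1 - t ^ 2)) / 2) *
            h (Real.sqrt E * t) * (∫ y in Set.Ioi (E * t ^ 2), Real.sqrt y * ((1 + y) ^ 4)⁻¹ * Real.exp (-y / R)))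
          - n (Real.sqrt E) * (Real.sqrt E * ((1 + E) ^ 4)⁻¹ * Real.exp (-E / R)) + Real.pi / 5 * Real.sqrt E * (Real.sqrt E * ((1 + E) ^ 4)⁻¹ * Real.exp (-E / R))|)
        (Set.Ioi 0) ∧
      ∫ E in Set.Ioi (0 : ℝ), (1 + E) * E *
        |2 * (Real.pi * ∫ t in (-1 : ℝ)..1, t ^ 2 * Real.exp (-(E * (1 - t ^ 2)) / 2) *
            h (Real.sqrt E * t) * (∫ y in Set.Ioi (E * t ^ 2), Real.sqrt y * ((1 + y) ^ 4)⁻¹ * Real.exp (-y / R)))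
          - n (Real.sqrt E) * (Real.sqrt E * ((1 + E) ^ 4)⁻¹ * Real.exp (-E / R)) + Real.pi / 5 * Real.sqrt E * (Real.sqrt E * ((1 + E) ^ 4)⁻¹ * Real.exp (-E / R))|
        ≤ M₁ := by
  intro h hc hh _ n hnm hn
  refine ⟨(Real.pi * 3202070) * Real.pi + 4 * Real.pi / 5, fun R hR => ?_⟩
  have hR0 : 0 < R := by linarith
  obtain ⟨hM2i, hM2v⟩ := k2r_ref_K1_model_M2
  obtain ⟨hMei, hMev⟩ := k2r_ref_K1_model_exp hR0
  have hF1 : Integrable (fun E : ℝ => (Real.pi * 3202070) * (Real.sqrt E * (1 + E))⁻¹) (volume.restrict (Ioi 0)) :=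
    hM2i.const_mul _
  have hF2 : Integrable (fun E : ℝ => (4 * Real.pi / 5) * (R⁻¹ * Real.exp (-E / R)))
      (volume.restrict (Ioi 0)) := hMei.const_mul _
  have hFi : Integrable (fun E : ℝ => (Real.pi * 3202070) * (Real.sqrt E * (1 + E))⁻¹
      + (4 * Real.pi / 5) * (R⁻¹ * Real.exp (-E / R))) (volume.restrict (Ioi 0)) := hF1.add hF2
  have hFv : ∫ E in Ioi (0:ℝ), ((Real.pi * 3202070) * (Real.sqrt E * (1 + E))⁻¹
      + (4 * Real.pi / 5) * (R⁻¹ * Real.exp (-E / R))) = (Real.pi * 3202070) * Real.pi + 4 * Real.pi / 5 := by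
    rw [integral_add hF1 hF2, integral_const_mul, integral_const_mul, hM2v, hMev]; ring
  -- measurability of the integrand
  have hgm := k2r_ref_K1_measurable_gain hc hR0
  have hthm := k2r_ref_K1_measurable_th R
  have hmeas : Measurable (fun E => (1 + E) * E *
      |2 * (Real.pi * ∫ t in (-1 : ℝ)..1, t ^ 2 * Real.exp (-(E * (1 - t ^ 2)) / 2) *
          h (Real.sqrt E * t) * (∫ y in Set.Ioi (E * t ^ 2), Real.sqrt y * ((1 + y) ^ 4)⁻¹ * Real.exp (-y / R)))
        - n (Real.sqrt E) * (Real.sqrt E * ((1 + E) ^ 4)⁻¹ * Real.exp (-E / R)) + Real.pi / 5 * Real.sqrt E * (Real.sqrt E * ((1 + E) ^ 4)⁻¹ * Real.exp (-E / R))|) := by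
    fun_prop
  -- pointwise domination
  have hptw : ∀ E ∈ Ioi (0:ℝ), (1 + E) * E *
      |2 * (Real.pi * ∫ t in (-1 : ℝ)..1, t ^ 2 * Real.exp (-(E * (1 - t ^ 2)) / 2) *
          h (Real.sqrt E * t) * (∫ y in Set.Ioi (E * t ^ 2), Real.sqrt y * ((1 + y) ^ 4)⁻¹ * Real.exp (-y / R)))
        - n (Real.sqrt E) * (Real.sqrt E * ((1 + E) ^ 4)⁻¹ * Real.exp (-E / R)) + Real.pi / 5 * Real.sqrt E * (Real.sqrt E * ((1 + E) ^ 4)⁻¹ * Real.exp (-E / R))|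
      ≤ (Real.pi * 3202070) * (Real.sqrt E * (1 + E))⁻¹ + (4 * Real.pi / 5) * (R⁻¹ * Real.exp (-E / R)) :=
    fun E hE => k2r_ref_K1_core hc hh hn hR hE
  have hint : IntegrableOn (fun E => (1 + E) * E *
      |2 * (Real.pi * ∫ t in (-1 : ℝ)..1, t ^ 2 * Real.exp (-(E * (1 - t ^ 2)) / 2) *
          h (Real.sqrt E * t) * (∫ y in Set.Ioi (E * t ^ 2), Real.sqrt y * ((1 + y) ^ 4)⁻¹ * Real.exp (-y / R)))
        - n (Real.sqrt E) * (Real.sqrt E * ((1 + E) ^ 4)⁻¹ * Real.exp (-E / R)) + Real.pi / 5 * Real.sqrt E * (Real.sqrt E * ((1 + E) ^ 4)⁻¹ * Real.exp (-E / R))|)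
      (Set.Ioi 0) := by
    refine Integrable.mono' hFi hmeas.aestronglyMeasurable ?_
    refine ae_restrict_of_forall_mem measurableSet_Ioi fun E hE => ?_
    rw [Real.norm_eq_abs, abs_of_nonneg (by have : (0:ℝ) < E := hE; positivity)]
    exact hptw E hE
  refine ⟨hint, ?_⟩
  calc _ ≤ ∫ E in Ioi (0:ℝ), ((Real.pi * 3202070) * (Real.sqrt E * (1 + E))⁻¹
        + (4 * Real.pi / 5) * (R⁻¹ * Real.exp (-E / R))) :=
        setIntegral_mono_on hint hFi measurableSet_Ioi hptw
    _ = _ := hFv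

/-- **Contraction of the `ℓ = 1` sector (K1)** — stub `kernelDipole` of the refutation line of
`AdjointEnskogTestFamilyR`.  For any continuous `h` with `0 ≤ h(a) - a₊ ≤ e^{-a²/2}` and any
measurable loss profile `n` with `πu ≤ n(u) ≤ π√(u²+3)`: with the dipole weight
`ϑ¹_R(E) = √E (1+E)⁻⁴ e^{-E/R}`, its tail `Θ̄¹_R` and the reduced dual gain
`g(E) = π ∫_{-1}^{1} t² e^{-E(1-t²)/2} h(√E t) Θ̄¹_R(E t²) dt`, the kernel
`2g(E) - n(√E)ϑ¹_R(E)` equals `-(π/5)√E ϑ¹_R(E)` up to an error whose `∫₀^∞ (1+E)E|·| dE` is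
bounded uniformly in `R ≥ 1`.  Proof: `h = (·)₊ + r₁` reduces `g` to
`π√E ∫₀¹ t³e^{-E(1-t²)/2}Θ̄¹_R(Et²)dt` plus an `O(e^{-E/2})` term; freezing `Θ̄¹_R(Et²)` at `t = 1`
costs an integrable error (increment bound + `∫₀¹ tE(1-t²)e^{-E(1-t²)/2} ≤ 2/E`); the main term
`2πΘ̄¹_R(E)/√E - π√Eϑ¹_R(E)` is handled by the exact identity
`2Θ̄¹_R = (4/5)Eϑ¹_R + (16/5)T - (4/(5R))S`; everything is dominated by
`C/(√E(1+E)) + (4π/5)R⁻¹e^{-E/R}`, whose integral is `Cπ + 4π/5`. -/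
theorem stub_kernelDipole :
  let th1 : ℝ → ℝ → ℝ := fun R E => Real.sqrt E * ((1 + E) ^ 4)⁻¹ * Real.exp (-E / R)
  let Tb1 : ℝ → ℝ → ℝ := fun R x => ∫ E in Set.Ioi x, th1 R E
  ∀ h : ℝ → ℝ, Continuous h → (∀ a, 0 ≤ h a - max a 0 ∧ h a - max a 0 ≤ Real.exp (-a ^ 2 / 2)) →
  (∀ a, h a - h (-a) = a) →
  ∀ n : ℝ → ℝ, Measurable n → (∀ u, 0 ≤ u → Real.pi * u ≤ n u ∧ n u ≤ Real.pi * Real.sqrt (u ^ 2 + 3)) →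
  ∃ M₁ : ℝ, ∀ R : ℝ, 1 ≤ R →
    let g : ℝ → ℝ := fun E => Real.pi * ∫ t in (-1 : ℝ)..1,
      t ^ 2 * Real.exp (-(E * (1 - t ^ 2)) / 2) * h (Real.sqrt E * t) * Tb1 R (E * t ^ 2)
    IntegrableOn (fun E => (1 + E) * E *
      |2 * g E - n (Real.sqrt E) * th1 R E + Real.pi / 5 * Real.sqrt E * th1 R E|) (Set.Ioi 0) ∧
    ∫ E in Set.Ioi (0 : ℝ), (1 + E) * E *
      |2 * g E - n (Real.sqrt E) * th1 R E + Real.pi / 5 * Real.sqrt E * th1 R E| ≤ M₁ :=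
  k2r_ref_K1_main

end Summit.AtomisticToContinuum.HydrodynamicLimit.Theorems.EnskogAdjointDuality
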